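import Summits.BirchSwinnertonDyer.BirchSwinnertonDyer.Theses.AdditiveKolyvaginRoad
import Summits.BirchSwinnertonDyer.BirchSwinnertonDyer.Theorems.AdditiveKolyvaginRoadManinFrameResidueProperTwistDegree
import HarnessLib

/-!
# Route `AdditiveKolyvaginRoad`, crux `ManinFrameResidueProper` (stmt-BirchSwinnertonDyer-20483):
# the RESHAPED composition of line `birth` — the crux BY NAME from the `p ∈ {5, 7}` stub S57, the
# Manin-free TWIST-DEGREE STEP (in place of S11), and three named print facts (helper, `--supports`)

Cell `pub/bsd-wall` (D-0120, W-ALL row 2), seat `bsd-wall-manin-p1` (prover). THEOREMS ONLY (no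
definition, no named fact, no `sorry`); nothing is booked, no item is closed. This thin file imports
the route file (for the decl name only) and the route-free helper
`AdditiveKolyvaginRoadManinFrameResidueProperTwistDegree.lean` (p540328).

WHAT IT IS. The registered skeleton `Cruxes/ManinFrameResidueProper/Lines/birth.lean` (v3) proves
`ManinFrameResidueProper` from two stubs BY NAME: S57 `stub_memberManinUnit_fiveSeven` (`p ∈ {5,7}`)
and S11 `stub_memberManinUnit_ordinary` (`p ≥ 11`, Edixhoven's exceptional locus). S11 is Manin's
conjecture (`p`-part) there — open in print. p540328 translated S11: its conclusion is EQUIVALENT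
(granted modularity, Edixhoven 1991 Thm. 3 in both tree renderings = the route items
`EdixhovenManinNonPotOrdinary` / `EdixhovenManinKodairaType`, and Dokchitser–Dokchitser 2015
Thm. 5.1 (1)) to the Manin-free **twist-degree step**

  (TDS) for every unstarred (G)-ordinary globally minimal member `V ∼ W` (`TypeGOrd V p`,
  `ord_p Δ_min(V) ≤ 4`) and every globally minimal model `W♭` of `V ⊗ χ_{p*}`: some conductor-level
  parametrisation datum `D` of `V` has `v_p(deg D) < v_p(deg D♭)` for every conductor-level
  parametrisation datum `D♭` of `W♭`

(Edixhoven 1991 §4 "case 2": the optimal degree of the STARRED twist class has exactly one more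
factor `p`). `maninFrameResidueProper_of_fiveSeven_of_twistDegreeStep` below is the composition
`ManinFrameResidueProper_of` of the skeleton with S11 REPLACED by (TDS) + the three facts — i.e. the
reshaped skeleton the lead/planner may register (S57 unchanged; S11 ↦ `stub_twistDegreeStep` with
the signature of the hypothesis `hTDS` below; `hEdx`, `hEdxK` are route items 20279-children by name,
`hDD` the Literature fact `dokchitser_padicValInt_minimalDiscriminantInt_eq_of_isogeny_of_not_dvd_degree`).
Sorry-free here because S57 and (TDS) enter as HYPOTHESES (this is a `--supports` reading, not a
closure: both are open in print).

References: [EdixhovenManin1991] Thm. 3, §4; [DokchitserDokchitser2015LocalInvariants] Thm. 5.1 (1);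
[HoffsteinLuo1997] Theorem (§1); [Darmon2004] Thm. 3.6; [JetchevSkinnerWan2017] §7.4.1.
-/

set_option autoImplicit false
-- the Theorems directory repeats the summit name (sibling precedent `SignedBaseChangeAssembly.lean`)
set_option linter.dupNamespace false

noncomputable section

open scoped Classical

open WeierstrassCurve NumberField Literature.NumberTheory.EllipticCurves
  Literature.NumberTheory.EllipticCurves.ModularForms
  Literature.NumberTheory.EllipticCurves.Rank1Residual
  Literature.NumberTheory.DiophantineGeometry IsDedekindDomain Rat.HeightOneSpectrum
  Summit.BirchSwinnertonDyer.Rank1Residual Summit.BirchSwinnertonDyer.Rank1Residual.Additive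
  Summit.BirchSwinnertonDyer.BirchSwinnertonDyer.Theses.AdditiveKolyvaginRoad

namespace Summit.BirchSwinnertonDyer.BirchSwinnertonDyer.Theorems.ManinFrameResidueProperTwistComposition

/-- **`ManinFrameResidueProper` from S57, the twist-degree step and three named facts** — the
composition `ManinFrameResidueProper_of` of `Lines/birth.lean` v3 with the `p ≥ 11` stub replaced
by the Manin-free (TDS) via `ManinFrameResidueProperTwistDegree.stub_memberManinUnit_ordinary_of_twistDegreeStep`
(p540328). Hypotheses: `hEdx`, `hEdxK` (route items = Edixhoven 1991 Thm. 3 facts), `hDD`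
(Dokchitser–Dokchitser 2015 Thm. 5.1 (1) fact), `h57` = the registered stub S57 VERBATIM as a
hypothesis, `hTDS` = the class-level twist-degree step at every AKR pair with `p ≥ 11`. Then: a
member datum with `p ∤ c` (S57 / TDS by prime range), prime-to-`p` transport to `W`
(`ManinFrameTransport.exists_modularParametrizationData_not_dvd_of_partner`, `Irr`), and the
Hoffstein–Luo frame (`ManinFrameFromDatum.exists_oddHeegnerFrame_of_exists_not_dvd`, PUB conjuncts
6–7). [cite: EdixhovenManin1991, Thm. 3 and §4] [cite: DokchitserDokchitser2015LocalInvariants, Thm. 5.1 (1)]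
[cite: HoffsteinLuo1997, Theorem (§1, pp. 435–436)] [cite: Darmon2004, Thm. 3.6] -/
theorem maninFrameResidueProper_of_fiveSeven_of_twistDegreeStep
    (hEdx : EdixhovenManinNonPotOrdinary) (hEdxK : EdixhovenManinKodairaType)
    (hDD : dokchitser_padicValInt_minimalDiscriminantInt_eq_of_isogeny_of_not_dvd_degree)
    (h57 : ∀ (_ : Literature.NumberTheory.EllipticCurves.ModularForms.exists_isNewformOf)
      (W : WeierstrassCurve ℚ) [W.IsElliptic] [W.IsGloballyMinimal] (p : ℕ) [Fact p.Prime]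
      [NeZero (W.conductorNorm ℤ)], 5 ≤ p → p < 11 → Addv W p → Irr W p →
      ((p < 11 ∨ ∃ (W' : WeierstrassCurve ℚ) (_ : W'.IsElliptic) (_ : W'.IsGloballyMinimal),
          IsIsogenous W W' ∧ TypeGOrd W' p ∧ padicValInt p W'.minimalDiscriminantInt ≤ 4) ∧
        (∃ (W' : WeierstrassCurve ℚ) (_ : W'.IsElliptic) (_ : W'.IsGloballyMinimal),
          IsIsogenous W W' ∧ ∀ (v : HeightOneSpectrum ℤ) (n : ℕ), natGenerator v = p →
            W'.kodairaSymbolAt v ≠ KodairaSymbol.Istar n)) →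
      (∀ (W' : WeierstrassCurve ℚ) [W'.IsElliptic] [W'.IsGloballyMinimal]
          (D' : ModularParametrizationData W' (W.conductorNorm ℤ)),
          IsIsogenous W W' → p ∣ D'.modularDegree) →
      ∃ (W₀ : WeierstrassCurve ℚ) (_ : W₀.IsElliptic) (_ : W₀.IsGloballyMinimal)
        (D₀ : ModularParametrizationData W₀ (W.conductorNorm ℤ)),
        IsIsogenous W W₀ ∧ ¬ (p : ℤ) ∣ D₀.c)
    (hTDS : ∀ (W : WeierstrassCurve ℚ) [W.IsElliptic] [W.IsGloballyMinimal] (p : ℕ) [Fact p.Prime],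
      11 ≤ p → Addv W p → Irr W p →
      ∀ (V : WeierstrassCurve ℚ) [V.IsElliptic] [V.IsGloballyMinimal] [NeZero (V.conductorNorm ℤ)]
        (Wf : WeierstrassCurve ℚ) [Wf.IsElliptic] [Wf.IsGloballyMinimal] [NeZero (Wf.conductorNorm ℤ)]
        (C : VariableChange ℚ), IsIsogenous W V → TypeGOrd V p →
        padicValInt p V.minimalDiscriminantInt ≤ 4 →
        C • V.quadraticTwist ((-1 : ℚ) ^ (p / 2) * p) = Wf →
        ∃ D : ModularParametrizationData V (V.conductorNorm ℤ),
          ∀ Df : ModularParametrizationData Wf (Wf.conductorNorm ℤ),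
            padicValNat p D.modularDegree < padicValNat p Df.modularDegree) :
    ManinFrameResidueProper := by
  intro hPub W _ _ p hp _ hp5 hadd hirr hres hall hr
  have hnf : exists_isNewformOf := hPub.2.2.2.2.2.1
  -- a member with a Manin-unit datum, by prime range: S57 below 11, (TDS) + facts from 11 on
  have hmem : ∃ (W₀ : WeierstrassCurve ℚ) (_ : W₀.IsElliptic) (_ : W₀.IsGloballyMinimal)
      (D₀ : ModularParametrizationData W₀ (W.conductorNorm ℤ)),
      IsIsogenous W W₀ ∧ ¬ (p : ℤ) ∣ D₀.c := by
    rcases lt_or_ge p 11 with h11 | h11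
    · exact h57 hnf W p hp5 h11 hadd hirr hres hall
    · exact ManinFrameResidueProperTwistDegree.stub_memberManinUnit_ordinary_of_twistDegreeStep hEdx
        hEdxK hDD hnf W p h11 hadd hirr hres (hTDS W p h11 hadd hirr)
  obtain ⟨W₀, hE₀, hM₀, D₀, hiso, hc₀⟩ := hmem
  haveI := hE₀
  haveI := hM₀
  -- transport to a datum of `W` with `p ∤ c`, then the Hoffstein–Luo odd Heegner frame
  obtain ⟨Dt, hc⟩ :=
    ManinFrameTransport.exists_modularParametrizationData_not_dvd_of_partner W hp.out hirr hiso D₀ hc₀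
  exact ManinFrameFromDatum.exists_oddHeegnerFrame_of_exists_not_dvd hnf hPub.2.2.2.2.2.2.1 W p hr
    (by omega) ⟨Dt, hc⟩

end Summit.BirchSwinnertonDyer.BirchSwinnertonDyer.Theorems.ManinFrameResidueProperTwistComposition

end
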